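import Mathlib
import Summits.KontsevichZagierPeriods.Zeta5Search.BrickHatStrip

/-!
# BrickHoleFamilies — zi-p2's THEOREM 10 LEMMA 10.1 (member bookkeeping): the three offset families of a HOLE cell
`K = K₀ + K'p` (`N₀ < K₀ < p`) of a row `N = N₀ + (m+1)p` of either brick kernel, after division by `p`, are the
families of the cell `K'` of `F̃^{(m)}` times the hat member and the CLASS members (cell zeta5-irr)

HONEST FRAMING: systematic search; no irrationality claim unless certified. INSTRUMENT lemmas of the ζ(5)
census cell zeta5-irr (HOME `run/shared/lean/pub/zeta5-irr/`; memo `zi-p2/probes/B8/thm10/THEOREM10.md` (sealed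
eeb9a92811d678e0) LEMMA 10.1 «Let K = K′p + K₀ be a hole cell of (♮, N), N = N′p + N₀ ≥ p, n := N′. The p-divisible
distances x ∈ X_K, divided by p, are EXACTLY (with multiplicities) the distances of the cell K′ of K^{cl(K)}_n … (a) m − K
≡ 0 (mod p) iff m ≡ K₀ … m″ ≤ N′ − 1 (as K₀ > N₀) … (b) K + m ≡ 0 iff m ≡ p − K₀ … m″ + 1 ≤ N′ + ε₁ … (c) N + m − K ≡ 0
iff m ≡ K₀ − N₀ … if K₀ ≤ 2N₀ (ε₂ = 1) iff m″ ≤ N′; if K₀ > 2N₀ iff m″ ≤ N′ − 1», classes `ε₁ = [K₀ + N₀ ≥ p]`,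
`ε₂ = [K₀ ≤ 2N₀]`). THEOREM 9's off-digit cells (`BrickHatStrip`, `N₀ = 0`) are the class `ε₁ = ε₂ = 0`. Nothing here is
about ζ(5); no irrationality content; filing moves no rung. Filed by the engine seat zi-eng (g10); same unit-factor
machinery as `BrickHatStrip` (`BrickDigitStrip.prod_split/prod_unit_eq/prod_div_eq`).

## The statements (`p` prime, `N₀ < K₀ < p`, `K' ≤ m`; `N = N₀ + (m+1)p`, `K = K₀ + K'p`; carries
`ε₁ = (N₀ + K₀)/p`, `ε₂ = (N₀ + (N₀ + p − K₀))/p ∈ {0,1}`)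

* `den_family_hole`: `∏_{t ≤ N, t ≠ K}(pX + (t − K)) = C(c)·[∏_{t' ≤ m, t' ≠ K'}(X + (t' − K'))]·V`;
* `num_family_one_hole`: `∏_{t=1}^{N}(pX − (K+t)) = C(c)·[∏_{t'=1}^{m+1+ε₁}(X − (K'+t'))]·V`;
* `num_family_two_hole`: `∏_{t=1}^{N}(pX + (N+t−K)) = C(c)·[∏_{t=1}^{m+1+ε₂}(X + (m+t−K'))]·V`;
`V` unit polynomials, `c ≠ 0`. The members `t' ≤ m` / `t ≤ m` are those of `F̃_{K'}^{(m)}`, the member `m+1` is the hat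
member of THEOREM 9, the member `m+2` (present iff `ε₁ = 1` resp. `ε₂ = 1`) is the class member of THEOREM 10.
-/

namespace Summit.KontsevichZagierPeriods.Zeta5Search.BrickHoleFamilies

open Finset Nat Polynomial WithZero
open Summit.KontsevichZagierPeriods.Zeta5Search.BrickDigitStrip (prod_split IsUnitPoly prod_unit_eq prod_div_eq
  padicValuation_intCast_eq_one_of)
open Literature.NumberTheory.LFunctions (padicValuation_natCast_eq_one padicValuation_natCast_le_one)

noncomputable section

variable {p : ℕ} [Fact p.Prime]

omit [Fact p.Prime] in
/-- The class carries are `0` or `1`: `(N₀ + K₀)/p ≤ 1` and `(N₀ + (N₀ + p − K₀))/p ≤ 1` for `N₀ < K₀ < p`. -/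
theorem hole_carry_le_one {N₀ K₀ : ℕ} (hNK : N₀ < K₀) (hK₀ : K₀ < p) :
    (N₀ + K₀) / p ≤ 1 ∧ (N₀ + (N₀ + p - K₀)) / p ≤ 1 := by
  have hp : 0 < p := by omega
  exact ⟨Nat.lt_succ_iff.1 ((Nat.div_lt_iff_lt_mul hp).2 (by omega)),
    Nat.lt_succ_iff.1 ((Nat.div_lt_iff_lt_mul hp).2 (by omega))⟩

section families

variable {N₀ K₀ m K' : ℕ} (hNK : N₀ < K₀) (hK₀ : K₀ < p) (hK' : K' ≤ m)
include hNK hK₀ hK'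

omit hK' in
/-- DENOMINATORS of a hole cell: `∏_{t ≤ N, t ≠ K}(pX + (t − K)) = C(c)·[∏_{t' ≤ m, t' ≠ K'}(X + (t' − K'))]·V`
(members `t = K₀ + t'p`, `t' ≤ m` exactly because `K₀ > N₀`, `t' ≠ K'`). -/
theorem den_family_hole :
    ∃ V : ℚ[X], IsUnitPoly p V ∧ ∃ c : ℚ, c ≠ 0 ∧
      ∏ t ∈ (range (N₀ + (m + 1) * p + 1)).erase (K₀ + K' * p), (C (p : ℚ) * X + C ((t : ℚ) - (K₀ + K' * p : ℕ))) =
        C c * (∏ t ∈ (range (m + 1)).erase K', (X + C ((t : ℚ) - K'))) * V := by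
  have hp : p.Prime := Fact.out
  have hp0 : 0 < p := hp.pos
  have hKmod : (K₀ + K' * p) % p = K₀ := by rw [Nat.add_mul_mod_self_right, Nat.mod_eq_of_lt hK₀]
  have hg : ∀ t ∈ (range (m + 1)).erase K',
      K₀ + t * p ∈ (range (N₀ + (m + 1) * p + 1)).erase (K₀ + K' * p) ∧ (K₀ + t * p) % p = K₀ := by
    intro t ht
    have ht' := mem_range.1 (mem_erase.1 ht).2
    have htj := (mem_erase.1 ht).1
    have h1 : t * p ≤ m * p := Nat.mul_le_mul_right _ (by omega)
    have h2 : (m + 1) * p = m * p + p := by ring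
    refine ⟨mem_erase.2 ⟨fun h => htj (Nat.eq_of_mul_eq_mul_right hp0 (by omega)), mem_range.2 (by omega)⟩, ?_⟩
    rw [Nat.add_mul_mod_self_right, Nat.mod_eq_of_lt hK₀]
  have hinj : Set.InjOn (fun t => K₀ + t * p) ((range (m + 1)).erase K' : Finset ℕ) :=
    fun t₁ _ t₂ _ h => Nat.eq_of_mul_eq_mul_right hp0 (by simpa using h)
  have hsurj : ∀ t ∈ (range (N₀ + (m + 1) * p + 1)).erase (K₀ + K' * p), t % p = K₀ →
      ∃ t' ∈ (range (m + 1)).erase K', K₀ + t' * p = t := by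
    intro t ht hmod
    have ht' := mem_range.1 (mem_erase.1 ht).2
    have htK := (mem_erase.1 ht).1
    have hdec : K₀ + t / p * p = t := by
      have := Nat.mod_add_div t p; rw [hmod, mul_comm] at this; exact this
    refine ⟨t / p, mem_erase.2 ⟨fun h => htK (by rw [← hdec, h]), mem_range.2 ?_⟩, hdec⟩
    by_contra hcon
    have h1 : (m + 1) * p ≤ t / p * p := Nat.mul_le_mul_right _ (by omega)
    omega
  rw [prod_split (fun t => K₀ + t * p) (fun t => t % p = K₀) hg hinj hsurj]
  have hdivpart : ∏ t ∈ (range (m + 1)).erase K', (C (p : ℚ) * X + C (((K₀ + t * p : ℕ) : ℚ) - (K₀ + K' * p : ℕ))) =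
      C ((p : ℚ) ^ ((range (m + 1)).erase K').card) * ∏ t ∈ (range (m + 1)).erase K', (X + C ((t : ℚ) - K')) := by
    rw [← prod_div_eq]
    refine prod_congr rfl fun t _ => ?_
    congr 2; push_cast; ring
  have hunit : ∀ t ∈ ((range (N₀ + (m + 1) * p + 1)).erase (K₀ + K' * p)).filter (fun t => ¬ t % p = K₀),
      Rat.padicValuation p ((t : ℚ) - (K₀ + K' * p : ℕ)) = 1 := by
    intro t ht
    have ht' := (mem_filter.1 ht).2
    rw [show ((t : ℚ) - ((K₀ + K' * p : ℕ) : ℚ)) = (((t : ℤ) - (K₀ + K' * p : ℕ) : ℤ) : ℚ) by push_cast; ring]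
    refine padicValuation_intCast_eq_one_of fun hdvd => ht' ?_
    have h1 : ((K₀ + K' * p : ℕ) : ℤ) % (p : ℤ) = (t : ℤ) % (p : ℤ) := Int.ModEq.eq (Int.modEq_iff_dvd.2 hdvd)
    rw [← Int.natCast_mod, ← Int.natCast_mod, Nat.cast_inj, hKmod] at h1
    exact h1.symm
  obtain ⟨V, hV, hc, hVeq⟩ := prod_unit_eq hunit
  refine ⟨V, hV, (p : ℚ) ^ ((range (m + 1)).erase K').card *
    ∏ t ∈ ((range (N₀ + (m + 1) * p + 1)).erase (K₀ + K' * p)).filter (fun t => ¬ t % p = K₀),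
      ((t : ℚ) - (K₀ + K' * p : ℕ)),
    mul_ne_zero (pow_ne_zero _ (by exact_mod_cast hp.ne_zero)) hc, ?_⟩
  rw [hdivpart, hVeq, map_mul]
  ring

omit hK' in
/-- NUMERATORS I of a hole cell: `∏_{t=1}^{N}(pX − (K+t)) = C(c)·[∏_{t'=1}^{m+1+ε₁}(X − (K'+t'))]·V`, `ε₁ = (N₀+K₀)/p`
(`K + t = p(K'+t')` ↔ `t = t'p − K₀`; `t ≤ N` iff `t' ≤ m + 1 + ε₁`). -/
theorem num_family_one_hole :
    ∃ V : ℚ[X], IsUnitPoly p V ∧ ∃ c : ℚ, c ≠ 0 ∧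
      ∏ t ∈ Icc 1 (N₀ + (m + 1) * p), (C (p : ℚ) * X + C (-(((K₀ + K' * p : ℕ) : ℚ) + t))) =
        C c * (∏ t ∈ Icc 1 (m + 1 + (N₀ + K₀) / p), (X + C (-((K' : ℚ) + t)))) * V := by
  have hp : p.Prime := Fact.out
  have hp0 : 0 < p := hp.pos
  set e₁ := (N₀ + K₀) / p with he₁
  have he₁p : e₁ * p ≤ N₀ + K₀ := Nat.div_mul_le_self _ _
  have he₁lt : N₀ + K₀ < e₁ * p + p := Nat.lt_div_mul_add hp0
  have hg : ∀ t ∈ Icc 1 (m + 1 + e₁), t * p - K₀ ∈ Icc 1 (N₀ + (m + 1) * p) ∧ p ∣ (K₀ + K' * p) + (t * p - K₀) := by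
    intro t ht
    have ht' := mem_Icc.1 ht
    have hlo : p ≤ t * p := Nat.le_mul_of_pos_left p (by omega)
    have hhi : t * p ≤ (m + 1 + e₁) * p := Nat.mul_le_mul_right _ ht'.2
    have h3 : (m + 1 + e₁) * p = (m + 1) * p + e₁ * p := by ring
    refine ⟨mem_Icc.2 ⟨by omega, by omega⟩, ⟨K' + t, ?_⟩⟩
    have : p * (K' + t) = K' * p + t * p := by ring
    omega
  have hinj : Set.InjOn (fun t => t * p - K₀) (Icc 1 (m + 1 + e₁) : Finset ℕ) := by
    intro t₁ ht₁ t₂ ht₂ h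
    have h₁ : p ≤ t₁ * p := Nat.le_mul_of_pos_left p (by have := (mem_Icc.1 ht₁).1; omega)
    have h₂ : p ≤ t₂ * p := Nat.le_mul_of_pos_left p (by have := (mem_Icc.1 ht₂).1; omega)
    exact Nat.eq_of_mul_eq_mul_right hp0 (by simp only at h; omega)
  have hsurj : ∀ t ∈ Icc 1 (N₀ + (m + 1) * p), p ∣ (K₀ + K' * p) + t → ∃ t' ∈ Icc 1 (m + 1 + e₁), t' * p - K₀ = t := by
    intro t ht hdvd
    have ht' := mem_Icc.1 ht
    obtain ⟨q, hq⟩ := hdvd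
    rw [mul_comm p q] at hq
    have hjq : K' < q := by
      by_contra hcon
      have := Nat.mul_le_mul_right p (not_lt.1 hcon)
      omega
    have hqm : q ≤ K' + (m + 1 + e₁) := by
      by_contra hcon
      have h2 := Nat.mul_le_mul_right p (show K' + (m + 1 + e₁) + 1 ≤ q by omega)
      have h3 : (K' + (m + 1 + e₁) + 1) * p = K' * p + (m + 1) * p + e₁ * p + p := by ring
      omega
    have hsub : (q - K') * p = q * p - K' * p := Nat.sub_mul q K' p
    refine ⟨q - K', mem_Icc.2 ⟨by omega, by omega⟩, ?_⟩
    show (q - K') * p - K₀ = t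
    omega
  rw [prod_split (fun t => t * p - K₀) (fun t => p ∣ (K₀ + K' * p) + t) hg hinj hsurj]
  have hdivpart : ∏ t ∈ Icc 1 (m + 1 + e₁), (C (p : ℚ) * X + C (-(((K₀ + K' * p : ℕ) : ℚ) + ((t * p - K₀ : ℕ) : ℚ)))) =
      C ((p : ℚ) ^ (Icc 1 (m + 1 + e₁)).card) * ∏ t ∈ Icc 1 (m + 1 + e₁), (X + C (-((K' : ℚ) + t))) := by
    rw [← prod_div_eq]
    refine prod_congr rfl fun t ht => ?_
    have hlo : K₀ ≤ t * p := (Nat.le_mul_of_pos_left p (by have := (mem_Icc.1 ht).1; omega)).trans' hK₀.le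
    congr 2; push_cast [hlo]; ring
  have hunit : ∀ t ∈ (Icc 1 (N₀ + (m + 1) * p)).filter (fun t => ¬ p ∣ (K₀ + K' * p) + t),
      Rat.padicValuation p (-(((K₀ + K' * p : ℕ) : ℚ) + t)) = 1 := by
    intro t ht
    rw [Valuation.map_neg, ← Nat.cast_add]
    exact padicValuation_natCast_eq_one (mem_filter.1 ht).2
  obtain ⟨V, hV, hc, hVeq⟩ := prod_unit_eq hunit
  refine ⟨V, hV, _, mul_ne_zero (pow_ne_zero ((Icc 1 (m + 1 + e₁)).card) (by exact_mod_cast hp.ne_zero : (p : ℚ) ≠ 0))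
    hc, ?_⟩
  rw [hdivpart, hVeq, map_mul]
  ring

/-- NUMERATORS II of a hole cell: `∏_{t=1}^{N}(pX + (N+t−K)) = C(c)·[∏_{t=1}^{m+1+ε₂}(X + (m+t−K'))]·V`,
`ε₂ = (N₀ + (N₀ + p − K₀))/p` (`N + t − K = p(m + t − K')` ↔ `t = (K₀ − N₀) + (t−1)p`; `t ≤ N` iff `t ≤ m + 1 + ε₂`). -/
theorem num_family_two_hole :
    ∃ V : ℚ[X], IsUnitPoly p V ∧ ∃ c : ℚ, c ≠ 0 ∧
      ∏ t ∈ Icc 1 (N₀ + (m + 1) * p), (C (p : ℚ) * X + C ((((N₀ + (m + 1) * p : ℕ)) : ℚ) + t - (K₀ + K' * p : ℕ))) =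
        C c * (∏ t ∈ Icc 1 (m + 1 + (N₀ + (N₀ + p - K₀)) / p), (X + C ((m : ℚ) + t - K'))) * V := by
  have hp : p.Prime := Fact.out
  have hp0 : 0 < p := hp.pos
  set e₂ := (N₀ + (N₀ + p - K₀)) / p with he₂
  have he₂p : e₂ * p ≤ N₀ + (N₀ + p - K₀) := Nat.div_mul_le_self _ _
  have he₂lt : N₀ + (N₀ + p - K₀) < e₂ * p + p := Nat.lt_div_mul_add hp0
  have hKp : K' * p ≤ m * p := Nat.mul_le_mul_right _ hK'
  have e2 : (m + 1) * p = m * p + p := by ring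
  have hg : ∀ t ∈ Icc 1 (m + 1 + e₂), (K₀ - N₀) + (t - 1) * p ∈ Icc 1 (N₀ + (m + 1) * p) ∧
      p ∣ (N₀ + (m + 1) * p) + ((K₀ - N₀) + (t - 1) * p) - (K₀ + K' * p) := by
    intro t ht
    have ht' := mem_Icc.1 ht
    have hhi : (t - 1) * p ≤ (m + e₂) * p := Nat.mul_le_mul_right _ (by omega)
    have h3 : (m + e₂) * p = m * p + e₂ * p := by ring
    refine ⟨mem_Icc.2 ⟨by omega, by omega⟩, ⟨m + t - K', ?_⟩⟩
    have e1 : p * (m + t - K') = (m + t) * p - K' * p := by rw [mul_comm, Nat.sub_mul]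
    have e3 : (m + t) * p = m * p + (t - 1) * p + p := by
      rw [show m + t = m + (t - 1) + 1 by omega]; ring
    omega
  have hinj : Set.InjOn (fun t => (K₀ - N₀) + (t - 1) * p) (Icc 1 (m + 1 + e₂) : Finset ℕ) := by
    intro t₁ ht₁ t₂ ht₂ h
    have h₁ := (mem_Icc.1 ht₁).1
    have h₂ := (mem_Icc.1 ht₂).1
    have h' : (t₁ - 1) * p = (t₂ - 1) * p := by simp only at h; omega
    have := Nat.eq_of_mul_eq_mul_right hp0 h'
    omega
  have hsurj : ∀ t ∈ Icc 1 (N₀ + (m + 1) * p), p ∣ (N₀ + (m + 1) * p) + t - (K₀ + K' * p) →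
      ∃ t' ∈ Icc 1 (m + 1 + e₂), (K₀ - N₀) + (t' - 1) * p = t := by
    intro t ht hdvd
    have ht' := mem_Icc.1 ht
    obtain ⟨q, hq⟩ := hdvd
    rw [mul_comm p q] at hq
    -- `t = (K₀ − N₀) + (q − (m + 1 − K'))·p`
    have hlo : m + 1 - K' ≤ q := by
      by_contra hcon
      have h3 := Nat.mul_le_mul_right p (show q + 1 ≤ m + 1 - K' by omega)
      have h4 : (q + 1) * p = q * p + p := by ring
      have h5 : (m + 1 - K') * p = m * p + p - K' * p := by rw [Nat.sub_mul, e2]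
      omega
    have hhi : q ≤ 2 * m + 1 - K' + e₂ := by
      by_contra hcon
      have h3 := Nat.mul_le_mul_right p (show 2 * m + 1 - K' + e₂ + 1 ≤ q by omega)
      have h4 : (2 * m + 1 - K' + e₂ + 1) * p = 2 * (m * p) + p - K' * p + e₂ * p + p := by
        rw [add_mul, add_mul, one_mul, Nat.sub_mul, add_mul, one_mul, mul_assoc]
      omega
    refine ⟨q - (m + 1 - K') + 1, mem_Icc.2 ⟨by omega, by omega⟩, ?_⟩
    show (K₀ - N₀) + (q - (m + 1 - K') + 1 - 1) * p = t
    have hsub : (q - (m + 1 - K')) * p = q * p - (m + 1 - K') * p := Nat.sub_mul _ _ _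
    have h5 : (m + 1 - K') * p = m * p + p - K' * p := by rw [Nat.sub_mul, e2]
    have hle' : (m + 1 - K') * p ≤ q * p := Nat.mul_le_mul_right _ hlo
    rw [Nat.add_sub_cancel]
    omega
  rw [prod_split (fun t => (K₀ - N₀) + (t - 1) * p) (fun t => p ∣ (N₀ + (m + 1) * p) + t - (K₀ + K' * p))
    hg hinj hsurj]
  have hdivpart : ∏ t ∈ Icc 1 (m + 1 + e₂),
      (C (p : ℚ) * X + C ((((N₀ + (m + 1) * p : ℕ)) : ℚ) + (((K₀ - N₀) + (t - 1) * p : ℕ) : ℚ) - (K₀ + K' * p : ℕ))) =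
      C ((p : ℚ) ^ (Icc 1 (m + 1 + e₂)).card) * ∏ t ∈ Icc 1 (m + 1 + e₂), (X + C ((m : ℚ) + t - K')) := by
    rw [← prod_div_eq]
    refine prod_congr rfl fun t ht => ?_
    have ht1 := (mem_Icc.1 ht).1
    congr 2; push_cast [ht1, hNK.le]; ring
  have hunit : ∀ t ∈ (Icc 1 (N₀ + (m + 1) * p)).filter
      (fun t => ¬ p ∣ (N₀ + (m + 1) * p) + t - (K₀ + K' * p)),
      Rat.padicValuation p ((((N₀ + (m + 1) * p : ℕ)) : ℚ) + t - (K₀ + K' * p : ℕ)) = 1 := by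
    intro t ht
    have ht1 := (mem_Icc.1 (mem_filter.1 ht).1).1
    have hle : K₀ + K' * p ≤ (N₀ + (m + 1) * p) + t := by omega
    rw [← Nat.cast_add, ← Nat.cast_sub hle]
    exact padicValuation_natCast_eq_one (mem_filter.1 ht).2
  obtain ⟨V, hV, hc, hVeq⟩ := prod_unit_eq hunit
  refine ⟨V, hV, _, mul_ne_zero (pow_ne_zero ((Icc 1 (m + 1 + e₂)).card) (by exact_mod_cast hp.ne_zero : (p : ℚ) ≠ 0))
    hc, ?_⟩
  rw [hdivpart, hVeq, map_mul]
  ring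

end families

end

end Summit.KontsevichZagierPeriods.Zeta5Search.BrickHoleFamilies
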